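import Mathlib
import Summits.Ventures.HodgeRepro.Tier4.Line4.TailLayerCakeFibre

/-!
# Tier4/Line4/FibreDominatedOfTail — (7b)'s assembly in the `J`-form: the fibre sum dominates the off-fibre remainder from
some level on, from the tail bound `K e^{−(β−α) g N}`, `g N → ∞`, and the lower bound of the fibre sum

Blind re-derivation cell `pub-hodge-repro`, Tier 4 «PROVE THE STEP», LINE L4, seat t4-x2 (g4, reserve wall-breaker),
plan-4 g4's cut S15084 «x2 / L4-p2 — (7b)'s assembly = `exists_norm_J_sub_sum_orbital_le_family` (`F = E` the fibre) +
`hmain` on the fibre sum ⇒ `FibreDominatedFrom`», lead (R-28) S15087.  Tree path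
`lean/Summits/Ventures/HodgeRepro/Tier4/Line4/FibreDominatedOfTail.lean`.  0 print, no `def`.

THE STEP.  With `‖J(f N) − ∑_{o ∈ E} O_o(f N)‖ ≤ K e^{−δ g N}` (TailLayerCakeFibre, `δ = β − α > 0`), `g N → ∞`, and
`m ≤ ‖∑_{o ∈ E} O_o(f N)‖` from some level on (`m > 0`: C-L4-FIBREMAIN, L2-p1's), the remainder is `< m ≤` the fibre sum
from some level on — v0.34's `FibreDominated S χ χ' E (f N)` unfolded (`‖J − ∑_E O‖ < ‖∑_E O‖`), and `J(f N) ≠ 0`.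

* `exists_forall_exp_lt` — `K e^{−δ g N} < m` from some `N₀` on (`g → ∞`, `δ > 0`, `m > 0`).
* `exists_forall_norm_sub_lt_of_tail` — the abstract sequence form on `ℂ`-valued sequences `J`, `M`.
* `exists_fibreDominated_of_decay_count` — the RTF form on the binders of `exists_norm_J_sub_sum_orbital_le_family`
  (decay, region, count, `IsCharacter`s, the fibre `E`, the threshold `g`) + `Tendsto g atTop atTop` + `hmain`:
  `∃ N₀, ∀ N ≥ N₀, ‖S.J χ χ' (f N) − ∑ o ∈ E, S.orbital χ χ' o (f N)‖ < ‖∑ o ∈ E, S.orbital χ χ' o (f N)‖`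
  (= `L1Class.FibreDominatedFrom S χ χ' E f` once L1ClassV4 is on the tree — the body is this statement verbatim);
  `exists_J_ne_zero_of_decay_count` — `J(f N) ≠ 0` from some level on.

Nothing here says anything about the status of the Hodge conjecture for CM abelian varieties, which is NOT proved
(HC_CM is NOT proved by anyone in this repository).
-/

set_option autoImplicit false

noncomputable section

namespace Summit.Ventures.HodgeRepro.Tier4.Line4

open MeasureTheory Topology Filter Summit.Ventures.HodgeRepro.Tier4.Common
  Summit.Ventures.HodgeRepro.Tier4.Line1 Summit.Ventures.HodgeRepro.Tier4.Line1.RTF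

/-! ## 1. Sequences -/

section Sequences

/-- `K e^{−δ g N} < m` from some level on, for `g → ∞`, `δ > 0`, `m > 0`. -/
theorem exists_forall_exp_lt (K : ℝ) {δ : ℝ} (hδ : 0 < δ) (g : ℕ → ℝ) (hg : Tendsto g atTop atTop) {m : ℝ}
    (hm : 0 < m) : ∃ N₀ : ℕ, ∀ N ≥ N₀, K * Real.exp (-(δ * g N)) < m := by
  have h1 : Tendsto (fun N => -(δ * g N)) atTop atBot := by
    have := hg.const_mul_atTop hδ
    exact tendsto_neg_atTop_atBot.comp this
  have h2 : Tendsto (fun N => K * Real.exp (-(δ * g N))) atTop (𝓝 (K * 0)) :=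
    (Real.tendsto_exp_atBot.comp h1).const_mul K
  rw [mul_zero] at h2
  have h3 : ∀ᶠ N in atTop, K * Real.exp (-(δ * g N)) < m :=
    h2 (Iio_mem_nhds hm)
  obtain ⟨N₀, hN₀⟩ := eventually_atTop.1 h3
  exact ⟨N₀, hN₀⟩

/-- **The abstract step**: if `‖J N − M N‖ ≤ K e^{−δ g N}` for all `N`, `g → ∞`, and `m ≤ ‖M N‖` from some level on with
`m > 0`, then `‖J N − M N‖ < ‖M N‖` from some level on. -/
theorem exists_forall_norm_sub_lt_of_tail (J M : ℕ → ℂ) {K δ : ℝ} (hδ : 0 < δ) (g : ℕ → ℝ)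
    (hg : Tendsto g atTop atTop) (hK : ∀ N, ‖J N - M N‖ ≤ K * Real.exp (-(δ * g N)))
    (hmain : ∃ m : ℝ, 0 < m ∧ ∃ N₁ : ℕ, ∀ N ≥ N₁, m ≤ ‖M N‖) :
    ∃ N₀ : ℕ, ∀ N ≥ N₀, ‖J N - M N‖ < ‖M N‖ := by
  obtain ⟨m, hm, N₁, hN₁⟩ := hmain
  obtain ⟨N₂, hN₂⟩ := exists_forall_exp_lt K hδ g hg hm
  refine ⟨max N₁ N₂, fun N hN => ?_⟩
  calc ‖J N - M N‖ ≤ K * Real.exp (-(δ * g N)) := hK N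
    _ < m := hN₂ N (le_trans (le_max_right _ _) hN)
    _ ≤ ‖M N‖ := hN₁ N (le_trans (le_max_left _ _) hN)

/-- `J N ≠ 0` when the remainder is strictly smaller than the main term. -/
theorem ne_zero_of_norm_sub_lt {J M : ℂ} (h : ‖J - M‖ < ‖M‖) : J ≠ 0 := by
  intro h0
  rw [h0, zero_sub, norm_neg] at h
  exact lt_irrefl _ h

end Sequences

/-! ## 2. The RTF form: (7b)'s assembly in the `J`-form -/

section RTF

variable {G : Type} [Group G] [TopologicalSpace G] [IsTopologicalGroup G] [MeasurableSpace G] [BorelSpace G]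
  (S : Setting G) [SecondCountableTopology G]

/-- **(7b)'s assembly in the `J`-form** (plan-4 S15084, lead (R-28)): for a level family `f N` of continuous tests with a
level-uniform decay `‖f N z‖ ≤ C e^{−β d z}`, supports in a region `P` carrying a one-sided count of rate `α < β` on
compact pairs (`SublevelCount`), the threshold `g N` on the support off the fibre `E` (the coset sparsity off the fibre,
(R-27)), `g N → ∞`, and the fibre sum bounded below by `m > 0` from some level on: from some level on the fibre sum
dominates the remainder — `‖J(f N) − ∑_{o ∈ E} O_o(f N)‖ < ‖∑_{o ∈ E} O_o(f N)‖`, i.e. v0.34's `FibreDominatedFrom S χ χ' E f`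
unfolded. -/
theorem exists_fibreDominated_of_decay_count (f : ℕ → G → ℂ) (hf : ∀ N, Continuous (f N)) (d : G → ℝ)
    (hd : ∀ z, 0 ≤ d z) {C α β : ℝ} (hC : 0 ≤ C) (hαβ : α < β) (hβ : 0 ≤ β)
    (hdecay : ∀ N z, ‖f N z‖ ≤ C * Real.exp (-(β * d z)))
    (P : G → Prop) (hsupp : ∀ N z, f N z ≠ 0 → P z)
    (hcount : ∀ C₁ C₂ : Set G, IsCompact C₁ → IsCompact C₂ → ∃ C' : ℝ, 0 ≤ C' ∧ ∀ x ∈ C₁, ∀ y ∈ C₂, ∀ T : ℝ,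
      ∃ s : Finset S.Gk, (∀ γ : S.Gk, P (x⁻¹ * γ * y) → d (x⁻¹ * γ * y) ≤ T → γ ∈ s) ∧
        (s.card : ℝ) ≤ C' * Real.exp (α * T))
    {χ : S.T → ℂ} (hχ : S.IsCharacter χ) {χ' : S.T' → ℂ} (hχ' : S.IsCharacter' χ') (E : Finset S.Orbit)
    (g : ℕ → ℝ) (hg : Tendsto g atTop atTop)
    (hR : ∀ N, ∀ t ∈ closure S.DT, ∀ t' ∈ closure S.DT', ∀ γ : S.Gk, S.orbitOf γ ∉ E →
      f N ((t : G)⁻¹ * γ * t') ≠ 0 → g N ≤ d ((t : G)⁻¹ * γ * t'))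
    (hmain : ∃ m : ℝ, 0 < m ∧ ∃ N₁ : ℕ, ∀ N ≥ N₁, m ≤ ‖∑ o ∈ E, S.orbital χ χ' o (f N)‖) :
    ∃ N₀ : ℕ, ∀ N ≥ N₀, ‖S.J χ χ' (f N) - ∑ o ∈ E, S.orbital χ χ' o (f N)‖ <
      ‖∑ o ∈ E, S.orbital χ χ' o (f N)‖ := by
  obtain ⟨K, -, hK⟩ := exists_norm_J_sub_sum_orbital_le_family S f hf d hd hC hαβ hβ hdecay P hsupp hcount hχ hχ'
    E g hR
  exact exists_forall_norm_sub_lt_of_tail (fun N => S.J χ χ' (f N))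
    (fun N => ∑ o ∈ E, S.orbital χ χ' o (f N)) (sub_pos.2 hαβ) g hg hK hmain

/-- **`J(f N) ≠ 0` from some level on** (the wall's input `J ≠ 0` at a level `N ≥ N₀`). -/
theorem exists_J_ne_zero_of_decay_count (f : ℕ → G → ℂ) (hf : ∀ N, Continuous (f N)) (d : G → ℝ)
    (hd : ∀ z, 0 ≤ d z) {C α β : ℝ} (hC : 0 ≤ C) (hαβ : α < β) (hβ : 0 ≤ β)
    (hdecay : ∀ N z, ‖f N z‖ ≤ C * Real.exp (-(β * d z)))
    (P : G → Prop) (hsupp : ∀ N z, f N z ≠ 0 → P z)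
    (hcount : ∀ C₁ C₂ : Set G, IsCompact C₁ → IsCompact C₂ → ∃ C' : ℝ, 0 ≤ C' ∧ ∀ x ∈ C₁, ∀ y ∈ C₂, ∀ T : ℝ,
      ∃ s : Finset S.Gk, (∀ γ : S.Gk, P (x⁻¹ * γ * y) → d (x⁻¹ * γ * y) ≤ T → γ ∈ s) ∧
        (s.card : ℝ) ≤ C' * Real.exp (α * T))
    {χ : S.T → ℂ} (hχ : S.IsCharacter χ) {χ' : S.T' → ℂ} (hχ' : S.IsCharacter' χ') (E : Finset S.Orbit)
    (g : ℕ → ℝ) (hg : Tendsto g atTop atTop)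
    (hR : ∀ N, ∀ t ∈ closure S.DT, ∀ t' ∈ closure S.DT', ∀ γ : S.Gk, S.orbitOf γ ∉ E →
      f N ((t : G)⁻¹ * γ * t') ≠ 0 → g N ≤ d ((t : G)⁻¹ * γ * t'))
    (hmain : ∃ m : ℝ, 0 < m ∧ ∃ N₁ : ℕ, ∀ N ≥ N₁, m ≤ ‖∑ o ∈ E, S.orbital χ χ' o (f N)‖) :
    ∃ N₀ : ℕ, ∀ N ≥ N₀, S.J χ χ' (f N) ≠ 0 := by
  obtain ⟨N₀, hN₀⟩ := exists_fibreDominated_of_decay_count S f hf d hd hC hαβ hβ hdecay P hsupp hcount hχ hχ' E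
    g hg hR hmain
  exact ⟨N₀, fun N hN => ne_zero_of_norm_sub_lt (hN₀ N hN)⟩

end RTF

end Summit.Ventures.HodgeRepro.Tier4.Line4

end
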